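import Summits.AnomalousDissipation.AnomalousDissipation.Theorems.SolenoidalFractalHomogenisationLagrangianCarrierConstructionTowerData
import Summits.AnomalousDissipation.AnomalousDissipation.Theorems.SolenoidalFractalHomogenisationLagrangianCarrierConstructionTowerLevelContinuity
import Summits.AnomalousDissipation.AnomalousDissipation.Theorems.SolenoidalFractalHomogenisationLagrangianCarrierConstructionFlowsL
import Literature.Analysis.FluidPDE.AdditiveNoiseMeasurePreserving
import HarnessLib

/-!
# K3L `LagrangianCarrierConstruction` (stmt-AnomalousDissipation-24913), line `birth`: the Lagrangian insertion with the CONTINUITY clauses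
# (L1), (F1a) of `LevelRegular` on top of (L3a), (L4), (F1b), (F2) (helper; `--supports stmt-AnomalousDissipation-24913`)

Summits-side helper file (everything proved; no definitions, no named facts). `exists_isLagrangian_continuous`: over every Lagrangian
lattice carrier datum with commensurable refresh windows — (W1) every window of level `m+1` is a whole number of physical periods of
level `m+1`, (W2) the windows are nested — there are level fields / displacements with the same bookkeeping such that
`IsLagrangian` holds together with the following clauses of `LevelRegular`: (L1) every level field `b (m+1)` is JOINTLY continuous in
`(t, x)` — across the window resets too, because by (W1) the Eulerian level vanishes at every window boundary (its slot envelopes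
vanish at whole periods), so the inserted level is, on every CLOSED window, the window's fixed-frame formula
(`…TowerLevelContinuity.continuous_inserted_level`); (L3a) smooth in space; (L4) time periodic (period `refresh 1`); (F1a) every
displacement `disp m · s ·` is jointly continuous (`…TowerLevelContinuity.continuous_disp_of_slabs`); (F1b) smooth in space; (F2) `X m s s = id`,
group law, volume preservation. The tower itself is `…TowerData.exists_tower`. What is NOT here: (R0) (false at this generality,
`…Negative.StubFlowsLFalse.stub_flowsL_false`), (L2) weak divergence-freeness of the pushed-forward levels, (L3b)/(F1c) derivative bounds
uniform in time. Infrastructure for route-1's rung leaf F-D1.A0 (a frontier FORMAL rung); NOT a proof of anomalous dissipation.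
-/

set_option linter.dupNamespace false

noncomputable section

namespace Summit.AnomalousDissipation.AnomalousDissipation.Theorems.SolenoidalFractalHomogenisation.LagrangianCarrierConstruction

open Set Function Filter Topology Metric MeasureTheory
open scoped NNReal ContDiff
open Literature.Analysis Literature.Analysis.ODE Literature.Analysis.FunctionSpaces Literature.Analysis.FunctionSpaces.Torus
open Literature.Analysis.FluidPDE Literature.Analysis.FluidPDE.LatticeShear
open Summit.AnomalousDissipation.AnomalousDissipation.Theorems.SolenoidalFractalHomogenisation.PermissibleCarrier
  (isSmooth_level trapezoid_start_zero period_pos)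

/-- **The Lagrangian insertion with jointly continuous levels and displacements** (clauses `IsLagrangian`, (L1), (L3a), (L4), (F1a),
(F1b), (F2a–c) of the repaired `stub_flowsL`) under (W1), (W2). [cite: ArmstrongVicol2025, §2.2 (PDF pp. 12, 18: b_m = b_{m−1} + Σ_l 𝟙 v_m(t, X_{m−1}^{-1}(t,x,lτ″_m)); the flows X_m)] -/
theorem exists_isLagrangian_continuous : ∀ k (E : Literature.Analysis.FluidPDE.LatticeShear.LagrangianLatticeCarrier k), (∀ m, ∃ r : ℕ, 0 < r ∧ E.refresh (m + 1) = (r : ℝ) * E.toFractalCarrierData.physPeriod (m + 1)) → (∀ m, ∃ q : ℕ, 0 < q ∧ E.refresh m = (q : ℝ) * E.refresh (m + 1)) → ∃ E' : Literature.Analysis.FluidPDE.LatticeShear.LagrangianLatticeCarrier k, E'.toFractalCarrierData = E.toFractalCarrierData ∧ E'.refresh = E.refresh ∧ E'.θ = E.θ ∧ E'.IsLagrangian ∧ (∀ m, Continuous (Function.uncurry (E'.b (m + 1)))) ∧ (∀ m t, Torus.IsSmooth (E'.b (m + 1) t)) ∧ (∀ m, ∃ τ : ℝ, 0 < τ ∧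 Function.Periodic (E'.b (m + 1)) τ) ∧ (∀ m s, Continuous fun p : ℝ × UnitAddTorus (Fin 3) => E'.disp m p.1 s p.2) ∧ (∀ m t s, Torus.IsSmooth (E'.disp m t s)) ∧ (∀ m s, E'.X m s s = id) ∧ (∀ m t s r, E'.X m t s ∘ E'.X m s r = E'.X m t r) ∧ (∀ m t s, MeasureTheory.MeasurePreserving (E'.X m t s) volume volume) := by
  intro k E hW1 hW2
  -- the lifted Eulerian level fields
  obtain ⟨v, hv⟩ : ∃ v : ℕ → ℝ → EuclideanSpace ℝ (Fin 3) → EuclideanSpace ℝ (Fin 3),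
      ∀ m t z, v m t z = E.toFractalCarrierData.level m t (proj z) := ⟨_, fun _ _ _ => rfl⟩
  have hvE : ∀ m, v m = fun t z => E.toFractalCarrierData.level m t (proj z) := fun m => funext fun t => funext fun z => hv m t z
  have hvper : ∀ m t z (n : Fin 3 → ℤ), v m t (z + latticeVec n) = v m t z := fun m t z n => by
    rw [hv, hv, level_proj_add_latticeVec]
  have hvc : ∀ m, Continuous (uncurry (v m)) := fun m => by
    have h := (isUniformlyLipschitzOn_level_proj E.toFractalCarrierData m).continuousOn_uncurry convex_univ
    rw [univ_prod_univ, continuousOn_univ] at h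
    rw [hvE]; exact h
  -- (W1): the Eulerian level `m+1` vanishes at every window boundary of level `m+1`
  have hvan : ∀ m (j : ℤ) z, v (m + 1) ((j : ℝ) * E.refresh (m + 1)) z = 0 := by
    intro m j z
    obtain ⟨r, -, hr⟩ := hW1 m
    rw [hv, level_proj_eq_sum]
    have ha : E.toFractalCarrierData.a (m + 1) ≠ 0 := (E.toFractalCarrierData.a_pos _).ne'
    have hP : (E.toFractalCarrierData.word (m + 1)).period ≠ 0 := (period_pos _).ne'
    have hq : E.toFractalCarrierData.a (m + 1) * ((j : ℝ) * E.refresh (m + 1)) / (E.toFractalCarrierData.word (m + 1)).period =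
        ((j * r : ℤ) : ℝ) := by
      rw [hr]
      unfold FractalCarrierData.physPeriod
      push_cast
      field_simp
    rw [hq, Int.fract_intCast, zero_mul]
    simp only [trapezoid_start_zero, zero_smul, Finset.sum_const_zero, smul_zero]
  -- the tower
  obtain ⟨A, Bs, Ds, hB0, hBsucc, hINV, hDET, hPER, hINSper⟩ := exists_tower E hW1 hW2
  -- the inserted velocities
  obtain ⟨INS, hINS⟩ : ∃ INS : ℕ → ℝ → EuclideanSpace ℝ (Fin 3) → EuclideanSpace ℝ (Fin 3), ∀ m t z, INS m t z =
      fderiv ℝ (fun y => A m t ((A m ((⌊t / E.refresh (m + 1)⌋ : ℝ) * E.refresh (m + 1))).symm y))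
        (A m ((⌊t / E.refresh (m + 1)⌋ : ℝ) * E.refresh (m + 1)) ((A m t).symm z))
        (v (m + 1) t (A m ((⌊t / E.refresh (m + 1)⌋ : ℝ) * E.refresh (m + 1)) ((A m t).symm z))) := ⟨_, fun _ _ _ => rfl⟩
  have hBsucc' : ∀ m, Bs (m + 1) = fun t z => Bs m t z + INS m t z := fun m => by
    rw [hBsucc m]; funext t z; rw [hINS, hv]
  have hINSper' : ∀ m t z, INS m (t + E.refresh 1) z = INS m t z := fun m t z => by
    rw [hINS, hINS, hv, hv]; exact hINSper m t z
  -- the level fields and displacements on the torus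
  obtain ⟨bf, hb0, hbS⟩ : ∃ bf : ℕ → ℝ → UnitAddTorus (Fin 3) → EuclideanSpace ℝ (Fin 3),
      (∀ t x, bf 0 t x = 0) ∧ ∀ m t x, bf (m + 1) t x = INS m t (repr x) :=
    ⟨fun m t x => match m with | 0 => 0 | m + 1 => INS m t (repr x), fun _ _ => rfl, fun _ _ _ => rfl⟩
  obtain ⟨dsp, hdsp⟩ : ∃ dsp : ℕ → ℝ → ℝ → UnitAddTorus (Fin 3) → EuclideanSpace ℝ (Fin 3),
      ∀ m t s x, dsp m t s x = A m t ((A m s).symm (repr x)) - repr x := ⟨_, fun _ _ _ _ => rfl⟩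
  -- the partial sums of the level fields are the tower velocities
  have hsum : ∀ m t z, ∑ i ∈ Finset.range m, bf (i + 1) t (proj z) = Bs m t z := by
    intro m
    induction m with
    | zero => intro t z; simp [hB0]
    | succ n ih =>
      intro t z
      rw [Finset.sum_range_succ, ih, hBsucc', hbS]
      -- periodicity of the inserted velocity through `repr ∘ proj`
      have hper : ∀ y (k' : Fin 3 → ℤ), INS n t (y + latticeVec k') = INS n t y := fun y k' =>
        by rw [hINS, hINS]; exact inserted_add_latticeVec (A n) (v (n + 1)) t _ (hINV n).1 (hvper _) y k'
      simp only []
      rw [periodic_repr_proj hper]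
  -- smoothness of the tower at all orders
  have hAinf : ∀ m t, ContDiff ℝ ∞ (A m t) ∧ ContDiff ℝ ∞ (A m t).symm := fun m t => by
    obtain ⟨-, i3, i3', -, -, -, -, -, -, -, -, -⟩ := hINV m
    constructor
    · refine contDiff_infty.2 fun n => ?_
      obtain ⟨ε, hε, hR1, -⟩ := i3 (max n 1) (le_max_right _ _) t
      have h := hR1.comp_contDiff (contDiff_const.prodMk contDiff_id) fun _ => ⟨⟨le_rfl, by linarith⟩, mem_univ _⟩
      exact h.of_le (by exact_mod_cast le_max_left n 1)
    · refine contDiff_infty.2 fun n => ?_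
      obtain ⟨ε, hε, hR1, -⟩ := i3' (max n 1) (le_max_right _ _) t
      have h := hR1.comp_contDiff (contDiff_const.prodMk contDiff_id) fun _ => ⟨⟨le_rfl, by linarith⟩, mem_univ _⟩
      exact h.of_le (by exact_mod_cast le_max_left n 1)
  have hXeqm : ∀ m t s z (k' : Fin 3 → ℤ), A m t ((A m s).symm (z + latticeVec k')) = A m t ((A m s).symm z) + latticeVec k' :=
    fun m t s z k' => by rw [equivariant_symm ((hINV m).1 s), (hINV m).1]
  refine ⟨⟨E.toFractalCarrierData, E.refresh, E.θ, bf, dsp, E.refresh_pos, E.θ_pos⟩, rfl, rfl, rfl, fun m => ⟨?_, ?_⟩,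
    fun m => ?_, fun m t => ?_, fun m => ⟨E.refresh 1, E.refresh_pos 1, fun t => ?_⟩, fun m s => ?_, fun m t s => ?_, fun m s => ?_,
    fun m t s r => ?_, fun m t s => ?_⟩
  · -- `IsFlow m`: the integral form of the flow equation of `A m`
    intro t s x
    obtain ⟨i1, i3, -, i4, -, -, i5, i7a, i7b, i7c, -, -⟩ := hINV m
    have i3₁ := i3 1 le_rfl
    set z₀ : EuclideanSpace ℝ (Fin 3) := (A m s).symm (repr x) with hz₀
    show dsp m t s x = ∫ r in s..t, ∑ i ∈ Finset.range m, bf (i + 1) r (x + proj (dsp m r s x))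
    have hX : ∀ r, x + proj (dsp m r s x) = proj (A m r z₀) := fun r => by
      rw [hdsp]; exact add_proj_disp_eq (fun y => A m r ((A m s).symm y)) x
    simp only [hX, hsum]
    have hcontA : Continuous fun r => A m r z₀ := continuous_apply_of_slabs (A m) i3₁ z₀
    have hcont : Continuous fun r => A m r z₀ - repr x := hcontA.sub continuous_const
    have hderiv : ∀ r ∉ Ds m, HasDerivAt (fun r => A m r z₀ - repr x) (Bs m r (A m r z₀)) r :=
      fun r hr => (i5 r hr z₀).sub_const _
    have hint : ∀ a b : ℝ, IntervalIntegrable (fun r => Bs m r (A m r z₀)) volume a b := by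
      refine intervalIntegrable_of_bounded_of_continuousAt_off_countable i4 (fun r hr => ?_) (fun a b => ?_)
      · exact ContinuousAt.comp_of_eq (i7c r hr (A m r z₀)) (continuous_id.prodMk hcontA).continuousAt rfl
      · obtain ⟨C, hC⟩ := i7b a b
        exact ⟨C, fun r hr => hC r hr _⟩
    rw [integral_eq_sub_of_hasDerivAt_off_countable i4 hcont hderiv hint s t, hdsp]
    have hFs : A m s z₀ = repr x := by rw [hz₀]; exact Equiv.apply_symm_apply _ _
    rw [hFs, sub_self, sub_zero]
  · -- `IsInserted m`: the level `m+1` field is the pushed-forward Eulerian level, window by window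
    intro j t ht y
    obtain ⟨i1, -, -, -, -, -, -, -, -, -, -, -⟩ := hINV m
    have hAc : ∀ τ, ContDiff ℝ 1 (A m τ) ∧ ContDiff ℝ 1 (A m τ).symm := fun τ =>
      ⟨(hAinf m τ).1.of_le (by exact_mod_cast le_top), (hAinf m τ).2.of_le (by exact_mod_cast le_top)⟩
    set s : ℝ := (j : ℝ) * E.refresh (m + 1) with hs
    -- the frame: equivariance and smoothness of `X(t, s) = A t ∘ (A s)⁻¹`
    have hXeq : ∀ z (k' : Fin 3 → ℤ), A m t ((A m s).symm (z + latticeVec k')) = A m t ((A m s).symm z) + latticeVec k' :=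
      fun z k' => by rw [equivariant_symm (i1 s), i1]
    have hXd : Differentiable ℝ fun z => A m t ((A m s).symm z) :=
      ((hAc t).1.comp (hAc s).2).differentiable (by simp)
    show bf (m + 1) t (y + proj (dsp m t s y)) =
      (ContinuousLinearMap.id ℝ (EuclideanSpace ℝ (Fin 3)) + fderiv ℝ (Torus.lift (dsp m t s)) (repr y))
        (E.toFractalCarrierData.level (m + 1) t y)
    -- left-hand side: the inserted velocity at the pushed point
    have hX : y + proj (dsp m t s y) = proj (A m t ((A m s).symm (repr y))) := by
      rw [hdsp]; exact add_proj_disp_eq (fun y' => A m t ((A m s).symm y')) y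
    have hper : ∀ z (k' : Fin 3 → ℤ), INS m t (z + latticeVec k') = INS m t z := fun z k' => by
      rw [hINS, hINS]; exact inserted_add_latticeVec (A m) (v (m + 1)) t _ i1 (hvper _) z k'
    have hfl : ⌊t / E.refresh (m + 1)⌋ = j := floor_eq_of_mem_Ico (E.refresh_pos _) ht
    rw [hX, hbS, periodic_repr_proj hper]
    simp only [hINS, hfl, ← hs, Equiv.symm_apply_apply, Equiv.apply_symm_apply, hv, proj_repr]
    -- right-hand side: the derivative of the lifted displacement
    have hl : Torus.lift (dsp m t s) = fun z => A m t ((A m s).symm z) - z := by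
      funext z
      have e : dsp m t s = fun x => (fun y' => A m t ((A m s).symm y')) (repr x) - repr x := funext fun x => hdsp m t s x
      rw [e]
      exact lift_disp_eq (F := fun y' => A m t ((A m s).symm y')) hXeq z
    have hF : HasFDerivAt (fun z => A m t ((A m s).symm z) - z)
        (fderiv ℝ (fun y' => A m t ((A m s).symm y')) (repr y) - ContinuousLinearMap.id ℝ (EuclideanSpace ℝ (Fin 3)))
        (repr y) := ((hXd _).hasFDerivAt).sub (hasFDerivAt_id _)
    rw [hl, hF.fderiv]
    simp

  · -- (L1) every level field is jointly continuous in `(t, x)` (the Eulerian level vanishes at the window boundaries)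
    obtain ⟨i1, i3, i3', -, -, -, -, -, -, -, -, -⟩ := hINV m
    exact continuous_inserted_level (A m) i1 (i3 1 le_rfl) (i3' 1 le_rfl) (v (m + 1)) (hvc _) (hvper _) (E.refresh_pos (m + 1))
      (hvan m) (bf (m + 1)) fun t x => by rw [hbS, hINS]
  · -- (L3a) every level field is smooth in space
    show ContDiff ℝ ∞ (Torus.lift (bf (m + 1) t))
    have hper : ∀ z (k' : Fin 3 → ℤ), INS m t (z + latticeVec k') = INS m t z := fun z k' => by
      rw [hINS, hINS]; exact inserted_add_latticeVec (A m) (v (m + 1)) t _ (hINV m).1 (hvper _) z k'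
    have hl : Torus.lift (bf (m + 1) t) = INS m t := by
      funext z; rw [Torus.lift_apply, hbS, periodic_repr_proj hper]
    rw [hl, show INS m t = fun z => INS m t z from rfl]
    simp only [hINS]
    set w : ℝ := (⌊t / E.refresh (m + 1)⌋ : ℝ) * E.refresh (m + 1) with hw
    have hF : ContDiff ℝ ∞ fun y => A m t ((A m w).symm y) := (hAinf m t).1.comp (hAinf m w).2
    have hq : ContDiff ℝ ∞ fun z => A m w ((A m t).symm z) := (hAinf m w).1.comp (hAinf m t).2
    have hvs : ContDiff ℝ ∞ fun y => v (m + 1) t y := by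
      have e : (fun y => v (m + 1) t y) = Torus.lift (E.toFractalCarrierData.level (m + 1) t) :=
        funext fun y => by rw [hv, Torus.lift_apply]
      rw [e]; exact isSmooth_level _ _ _
    have hD : ContDiff ℝ ∞ fun p : EuclideanSpace ℝ (Fin 3) × EuclideanSpace ℝ (Fin 3) =>
        fderiv ℝ (fun y => A m t ((A m w).symm y)) p.1 p.2 := hF.contDiff_fderiv_apply (by simp)
    exact hD.comp (hq.prodMk (hvs.comp hq))
  · -- (L4) every level field is time periodic with period `refresh 1`
    funext x
    show bf (m + 1) (t + E.refresh 1) x = bf (m + 1) t x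
    rw [hbS, hbS, hINSper']
  · -- (F1a) every displacement is jointly continuous in `(t, x)`
    obtain ⟨i1, i3, -, -, -, -, -, -, -, -, -, -⟩ := hINV m
    have hAs : ContDiff ℝ 1 (A m s).symm := (hAinf m s).2.of_le (by exact_mod_cast le_top)
    exact continuous_disp_of_slabs (A m) i1 (i3 1 le_rfl) s hAs (fun t x => dsp m t s x) fun t x => hdsp m t s x
  · -- (F1b) every displacement is smooth in space
    show ContDiff ℝ ∞ (Torus.lift (dsp m t s))
    have hl : Torus.lift (dsp m t s) = fun z => A m t ((A m s).symm z) - z := by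
      funext z
      have e : dsp m t s = fun x => (fun y' => A m t ((A m s).symm y')) (repr x) - repr x := funext fun x => hdsp m t s x
      rw [e]
      exact lift_disp_eq (F := fun y' => A m t ((A m s).symm y')) (hXeqm m t s) z
    rw [hl]
    exact ((hAinf m t).1.comp (hAinf m s).2).sub contDiff_id
  · -- (F2a) `X m s s = id`
    funext x
    show x + proj (dsp m s s x) = x
    rw [hdsp, add_proj_disp_eq (fun y' => A m s ((A m s).symm y')) x]
    simp only [Equiv.apply_symm_apply, proj_repr]
  · -- (F2b) the two-parameter group law
    funext x
    show (x + proj (dsp m s r x)) + proj (dsp m t s (x + proj (dsp m s r x))) = x + proj (dsp m t r x)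
    rw [hdsp m s r, add_proj_disp_eq (fun y' => A m s ((A m r).symm y')) x]
    rw [hdsp m t s, add_proj_disp_eq (fun y' => A m t ((A m s).symm y')) _]
    rw [hdsp m t r, add_proj_disp_eq (fun y' => A m t ((A m r).symm y')) x]
    obtain ⟨k', hk'⟩ := exists_repr_proj_eq_add_latticeVec_holds (A m s ((A m r).symm (repr x)))
    rw [hk', hXeqm m t s, Torus.proj_add_latticeVec]
    simp

  · -- (F2c) the flow maps preserve the volume of the torus (Liouville)
    have hAc : ContDiff ℝ 1 (A m t) ∧ ContDiff ℝ 1 (A m s).symm :=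
      ⟨(hAinf m t).1.of_le (by exact_mod_cast le_top), (hAinf m s).2.of_le (by exact_mod_cast le_top)⟩
    have hX1 : ContDiff ℝ 1 fun z => A m t ((A m s).symm z) := hAc.1.comp hAc.2
    refine Literature.Analysis.FluidPDE.Torus.measurePreserving_of_equivariant_det_one
      (X := fun z => A m t ((A m s).symm z)) (X' := fun y => fderiv ℝ (fun z => A m t ((A m s).symm z)) y)
      (fun y => ((hX1.differentiable (by simp)) y).hasFDerivAt) (fun y => ?_) ((A m s).symm.trans (A m t)).bijective
      (hXeqm m t s) ?_ (fun y => ?_)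
    · rw [det_fderiv_comp hAc.1 hAc.2, (hDET m t).1, (hDET m s).2, mul_one]
    · -- measurability: the torus map is continuous
      have hl : Torus.lift (dsp m t s) = fun z => A m t ((A m s).symm z) - z := by
        funext z
        have e : dsp m t s = fun x => (fun y' => A m t ((A m s).symm y')) (repr x) - repr x := funext fun x => hdsp m t s x
        rw [e]
        exact lift_disp_eq (F := fun y' => A m t ((A m s).symm y')) (hXeqm m t s) z
      have hc : Continuous (dsp m t s) := by
        rw [← Torus.continuous_lift_iff, hl]
        exact hX1.continuous.sub continuous_id
      have hX : Continuous fun x : UnitAddTorus (Fin 3) => x + proj (dsp m t s x) :=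
        continuous_id.add (Torus.continuous_proj.comp hc)
      exact hX.measurable
    · show proj y + proj (dsp m t s (proj y)) = proj (A m t ((A m s).symm y))
      rw [hdsp, add_proj_disp_eq (fun y' => A m t ((A m s).symm y')) (proj y)]
      obtain ⟨k', hk'⟩ := exists_repr_proj_eq_add_latticeVec_holds y
      rw [hk', hXeqm m t s, Torus.proj_add_latticeVec]

end Summit.AnomalousDissipation.AnomalousDissipation.Theorems.SolenoidalFractalHomogenisation.LagrangianCarrierConstruction

end
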